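import Summits.HodgeConjecture.HodgeConjecture.Theorems.F0P6aDatumOfInputsDefs
import Literature.AlgebraicGeometry.AbelianSchemes.IdealTorsionStableSubgroups
import Literature.AlgebraicGeometry.AbelianSchemes.AbelianSchemeFibreAlongIntegralPoint
import Literature.NumberTheory.NumberFields.SerreTensorPresentationOfIdeal
import Literature.GroupTheory.StableSubgroupsTransport
import Literature.AlgebraicGeometry.AbelianSchemes.IdealTorsionDockTransport
import Literature.AlgebraicGeometry.AbelianSchemes.IdealTorsionSubgroupSchemeAction
import Literature.AlgebraicGeometry.GroupSchemes.AdmissibleIdealSpecialFibre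
import Literature.AlgebraicGeometry.GroupSchemes.AdmissibleIdealTransport
import Literature.AlgebraicGeometry.GroupSchemes.AdmissibleIdealsOfPointSubgroups
import Literature.AlgebraicGeometry.GroupSchemes.CanonicalLineAssembly
import Literature.AlgebraicGeometry.GroupSchemes.AdmissibleIdealSpecialFibreSurjective
import Literature.AlgebraicGeometry.GroupSchemes.UnitComponentClopen
import Literature.AlgebraicGeometry.AbelianSchemes.AbelianSchemeFibreAlongIntegralPointIso
import Literature.AlgebraicGeometry.AbelianSchemes.LevelStructureCoprimeChar
import HarnessLib
import HarnessLib.Audit.LibrarySuggestionsDenyListCruxes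

/-!
# `F0P6aLineSpecialisationLetters` — ★ RE-HOME of the crux workfile `Lines/F0_P6a_LineSpecialisation.lean` (tree ED. 3 sha16 d6354130763e131e, 1864 l., 119 declaration commands, code-`sorry`-free), PART 1 of 6

This `Theorems/` module is the TREE BYTES of that workfile with the NAMESPACE KEPT, so every fully-qualified name is UNCHANGED; only this module docstring is re-headed,
the `Lines` imports are switched to their ★ re-homed twins — `Lines.F0_P6a_DatumOfInputs` → ★ `Theorems.F0P6aDatumOfInputsDefs` — and the audit carrier `LibrarySuggestionsDenyListCruxes` is CARRIED on this root part (bare import, LEAD «M-142d» (1) rule «P-κ»; parts 2…n inherit it transitively)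
Why a re-home: a `Theorems/` file cannot import a `Lines/` workfile (F0P6-ref1 o-6), and closing stmt-HodgeConjecture-24832 `--as proved --by <Theorems decl>` at rung 0 needs the
sorry-free `Lines` chain behind the gate (RE-HOME TABLE v1.7, LA7-plan (g7); PLAN «L3 cone RE-HOME» v1, LA3-plan (g5); LEAD F0P6-plan (g5) «M-140» (1)∕(4), 2026-09-02).
SIZE LINT (`Theorems/` files with proofs ≤ 400 l.): the workfile is cut into 6 consecutive parts `F0P6aLineSpecialisationLetters` → `F0P6aLineSpecialisationLayer` → `F0P6aLineSpecialisationFibres` → `F0P6aLineSpecialisationGeneric` → `F0P6aLineSpecialisationLaws` → `F0P6aLineSpecialisation`; this is PART 1 (tree lines :1–:296); each later part imports the previous one and re-opens the scopes open at its cut with their `variable`∕`open`∕`set_option` lines replayed verbatim; the LAST part `F0P6aLineSpecialisation` is the module the `Lines/` shim and consumers import.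
After the chain is ★ the `Lines` workfile becomes a one-import SHIM of `F0P6aLineSpecialisation` (a `Lines/` write, batched per cone on the LEAD՚s word), so no environment holds two copies (NO-CROSS-IMPORT).
It asserts nothing beyond what the workfile already proves.  HC_CM is proved only modulo the 7 printed citations (2 remaining: hLiu418 = stmt-HodgeConjecture-24832, h413 = stmt-HodgeConjecture-24833) until rung 0 closes; a re-home is count-neutral.

## Original module docstring (verbatim)
# LS LEAFLET §2 (HOME cand, LA2-p04 g0): `#LineOf I y = q + 1` — DOWN → UP from the dock at `red₀ y`

HOME-first candidate for §2 of LA2-plan's «LS LEAFLET» `Cruxes/HLiu418/Lines/F0_P6a_LineSpecialisation.lean` (deal 2026-09-02T02:54:37Z); namespace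
`Summit.HodgeConjecture.HodgeConjecture.Cruxes.HLiu418.F0P6aLineSpecialisation`; imports the served D-LINE ED. 1 + ★ only; sorry-free when done; the pen
(LA2-plan) folds it into the leaflet.  HC_CM is proved only modulo the 7 printed citations (2 remaining: hLiu418 24832, h413 24833) until rung 0 closes.

ROAD (census 03:0xZ): `LineOf I y` IS ★ (L-q-sub)'s carrier of `ι`-stable order-`q` subgroups of `𝔭_{c•w}`-torsion `Ω̄`-points of the fibre abelian scheme
`A_y := schΩOf … I.univ y` with the doubly base-changed action (definitionally); ★ `natCard_stableSubgroups_eq_succ` turns the count into the ONE input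
`#A_y[𝔭](Ω̄) = q²`, which is read DOWN → UP: lift the tuple over the valuation ring `R ⊆ Ω̄` along `x̃ = extendPoint …` (★ `ProperIntegralPoints`), transport
the dock `𝔡 (red₀ y)` (`G₀ ↪ A_{red₀ y}`, kernel-of-`𝔭` clause, rank `q²`) to the special fibre of the lift along the equivariant iso ★
`exists_iso_fibre_baseChange_of_comp_eq` (★ `left_geomReductionMap_comp_fst`), count the `𝔭`-torsion `Ω̄`-points of the lift by ★ (GF)
`natCard_idealTorsion_algPoints_baseChange_eq_finrank_of_forall_iff`, and carry the count back to `A_y` along the equivariant generic iso (★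
`left_specFractionFieldι_comp_extendPoint_modelPointsEquiv_symm`, ★ (TR) `natCard_stableSubgroups_congr`).  ELABORATION NOTE: the concrete `Ω̄ = AlgebraicClosure (F_w)` carries Mathlib's direct
`CommRing` instance while ★ (L-q-sub) §3, stated for a generic field `K`, instantiates to `Field.toCommRing`; the two are definitionally equal but costly to unify inside
the big types, so the count is routed through the generic-`K` abbreviation `KCount` and ONE isolated `rfl` cast (`natCard_eq_kCount`).
-/

set_option autoImplicit false
set_option linter.dupNamespace false
-- `X.toAffine.toAbelianVariety.X = X.X`, `(Over.mk f).left` etc. are definitional only above `instances` transparency (as in ★ (S-H-A)).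
-- (from ED. 2 on, `backward.isDefEq.respectTransparency false` is scoped per declaration, LEAD «M-64b».)

noncomputable section

namespace Summit.HodgeConjecture.HodgeConjecture.Cruxes.HLiu418.F0P6aLineSpecialisation

open CategoryTheory CategoryTheory.Limits NumberField IsDedekindDomain MulAction AlgebraicGeometry
open scoped Matrix Polynomial Pointwise MonoidalCategory
open Literature.NumberTheory.GaloisRepresentations
open Literature.NumberTheory.Automorphic Literature.NumberTheory.Automorphic.UnitaryGroup
open Literature.AlgebraicGeometry.ShimuraVarieties.UnitaryCanonicalModel
open Literature.NumberTheory.Automorphic.Liu2021.AppendixC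
open Literature.AlgebraicGeometry.Motives (AlgPoints IntegralModel SchemeOver thickening thickeningGalAction thickeningLift specOver extendPoint
  specValuationSubring specFractionFieldι specRingHomι)
open Literature.NumberTheory.DiophantineGeometry (geomResidueField specialFibreFunctor specResidueField geomClosedPointIsoSpecResidueField
  geomResidueFieldEquiv toClosureValuationSubring)
open Literature.AlgebraicGeometry.RelativeSpec (ActionOver)
open Literature.NumberTheory.EllipticCurves (genericFibre specGenericPoint)
open Literature.AlgebraicGeometry.AbelianSchemes Literature.AlgebraicGeometry.AbelianSchemes.AbelianSchemeOver
open Literature.AlgebraicGeometry.GroupSchemes.AffineGroupScheme (Alg)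
open Summit.HodgeConjecture.HodgeConjecture.Cruxes.HLiu418.F0P6aModuliDatumDefs
open Summit.HodgeConjecture.HodgeConjecture.Cruxes.HLiu418.F0P6aRGDAssembly
open Summit.HodgeConjecture.HodgeConjecture.Cruxes.HLiu418.F0P6aDatumOfInputs

/-! ## §0 THE SEAM (ED. 2; LA1-p04 (g0) `LineSpecialisation.sec0.seam.v1` 289be0a5 by copy, lettered by LA2-p02 (g0)): the residue map `toGeomκ`, the
valuative lift `liftOf`, the lifted family `famOf`∕`actFamOf`, the special∕generic equivariant fibre isos and the transported dock — typed ONCE for §1∕§3. -/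


/-! ### (σ0) The residue algebra `R → κ(R) ≅ κ̄(w)` -/

section Residue

variable {F : Type} [Field F] [NumberField F]

set_option backward.isDefEq.respectTransparency false in
/-- **(σ0) `toGeomκ w : R → κ̄(w)`** — the valuation ring `R = closureValuationSubring (F_w) ⊆ Ω̄` modulo its maximal ideal, followed by the INVERSE of the ★
identification `κ̄(w) ≃ κ(R)` (`geomResidueFieldEquiv`).  This is the `Algebra R (geomResidueField w)` under which ★ `spI K κ 𝒢` (§1) and the ★ (GF)∕(L-q-sub)∕(GP) dock
forms (§2) read the special fibre of the lift. [cite: SerreTate1968, §1 Lemma 2] -/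
def toGeomκ (w : HeightOneSpectrum (𝓞 F)) : ↥(closureValuationSubring (w.adicCompletion F)) →+* geomResidueField w :=
  ((geomResidueFieldEquiv w).symm : IsLocalRing.ResidueField ↥(closureValuationSubring (w.adicCompletion F)) →+* geomResidueField w).comp
    (IsLocalRing.residue ↥(closureValuationSubring (w.adicCompletion F)))

set_option backward.isDefEq.respectTransparency false in
/-- **`Spec (toGeomκ w) = c ≫ s_R`** — the ★ (d5) geometric closed point of `Spec R` (`c := (geomClosedPointIsoSpecResidueField w)⁻¹`, `s_R := Spec (residue R)`).
[cite: SerreTate1968, §1 Lemma 2] -/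
theorem specMap_toGeomκ_eq (w : HeightOneSpectrum (𝓞 F)) :
    Spec.map (CommRingCat.ofHom (toGeomκ w)) =
      (geomClosedPointIsoSpecResidueField w).inv.left ≫
        (specRingHomι (closureValuationSubring (w.adicCompletion F)) (toClosureValuationSubring w)
          (IsLocalRing.residue ↥(closureValuationSubring (w.adicCompletion F)))).left := by
  rw [toGeomκ, CommRingCat.ofHom_comp, Spec.map_comp]
  rfl

set_option backward.isDefEq.respectTransparency false in
/-- Under `letI := (toGeomκ w).toAlgebra`, `algebraMap R κ̄(w) = toGeomκ w` (Mathlib `RingHom.algebraMap_toAlgebra`). [cite: SerreTate1968, §1 Lemma 2] -/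
theorem algebraMap_eq_toGeomκ (w : HeightOneSpectrum (𝓞 F)) :
    letI := (toGeomκ w).toAlgebra
    algebraMap ↥(closureValuationSubring (w.adicCompletion F)) (geomResidueField w) = toGeomκ w :=
  RingHom.algebraMap_toAlgebra _

end Residue

/-! ### (σ1) The valuation-ring lift `ỹ = liftOf … y : Spec R ⟶ 𝓨` of `ℓ_e y` and the lifted family `famOf I y = univ ×_𝓨 Spec R` -/

section Lift

variable {F : Type} [Field F] [NumberField F] [IsCMField F] {ι₁ : F →+* ℂ} {Jstar : Matrix (Fin 2) (Fin 2) F}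
    {K₀ : C5.OpenCompactSubgroup ↥(finAdelic ↥(maximalRealSubfield F) F (IsCMField.complexConj F) 2 Jstar)}
    (S : RecordSystemGS F Jstar ι₁ K₀) {Fi : Type} [Field Fi] [Algebra F Fi] (Kc : C5.SmallLevel K₀)
    (𝓜 : IntegralModel (𝓞 F) F ((thickening F Fi).obj (S.M.obj Kc))) (w : HeightOneSpectrum (𝓞 F))

set_option backward.isDefEq.respectTransparency false in
/-- **(σ1) `liftOf … y : Spec R ⟶ 𝓨`** — the unique `R`-point of the proper model `𝓨 = (𝓜.localise w).total` extending the `Ω̄`-point `ℓ_e y` of its generic fibre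
(valuative criterion, ★ `extendPoint`; properness = `h𝓨.2`).  Explicit `(S Kc 𝓜 w h𝓨 e)` as ★ `red₀Of`. [cite: SerreTate1968, §1 Lemma 2] [cite: Hartshorne1977, II.4.7] -/
def liftOf (h𝓨 : (𝓜.localise w).IsSmoothProper 1) (e : Fi →ₐ[F] AlgebraicClosure (w.adicCompletion F))
    (y : AlgPoints (S.M.obj Kc) (AlgebraicClosure (w.adicCompletion F))) :
    specValuationSubring (closureValuationSubring (w.adicCompletion F)) (toClosureValuationSubring w) ⟶ (𝓜.localise w).total :=
  haveI : IsProper (𝓜.localise w).total.hom := h𝓨.2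
  extendPoint (closureValuationSubring (w.adicCompletion F)) (toClosureValuationSubring w) (𝓜.localise w).total
    ((𝓜.localise w).modelPointsEquiv.symm (thickeningLift e (S.M.obj Kc) y))

set_option backward.isDefEq.respectTransparency false in
/-- Unfolding `liftOf` (with the properness instance supplied by `h𝓨.2`). [cite: Hartshorne1977, II.4.7] -/
theorem liftOf_eq (h𝓨 : (𝓜.localise w).IsSmoothProper 1) (e : Fi →ₐ[F] AlgebraicClosure (w.adicCompletion F))
    (y : AlgPoints (S.M.obj Kc) (AlgebraicClosure (w.adicCompletion F))) :
    liftOf S Kc 𝓜 w h𝓨 e y =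
      (haveI : IsProper (𝓜.localise w).total.hom := h𝓨.2
       extendPoint (closureValuationSubring (w.adicCompletion F)) (toClosureValuationSubring w) (𝓜.localise w).total
         ((𝓜.localise w).modelPointsEquiv.symm (thickeningLift e (S.M.obj Kc) y))) := rfl

set_option backward.isDefEq.respectTransparency false in
/-- **GENERIC POINT EQUALITY** — `ℓ_e y ≫ ι_η = η_R ≫ ỹ` with `η_R = Spec (algebraMap R Ω̄)` (★ (d5) `left_specFractionFieldι_comp_extendPoint_modelPointsEquiv_symm`; the
`u ≫ x̃` shape of ★ (DT) §2∕§3). [cite: SerreTate1968, §1 Lemma 2] [cite: Hartshorne1977, II.4.7] -/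
theorem left_thickeningLift_comp_genericι_eq (h𝓨 : (𝓜.localise w).IsSmoothProper 1) (e : Fi →ₐ[F] AlgebraicClosure (w.adicCompletion F))
    (y : AlgPoints (S.M.obj Kc) (AlgebraicClosure (w.adicCompletion F))) :
    (thickeningLift e (S.M.obj Kc) y).left ≫
        ((𝓜.localise w).genericIso'.inv.left ≫
          pullback.fst (𝓜.localise w).total.hom (specGenericPoint (HeightOneSpectrum.valuationSubringAtPrime F w) F)) =
      Spec.map (CommRingCat.ofHom (algebraMap ↥(closureValuationSubring (w.adicCompletion F)) (AlgebraicClosure (w.adicCompletion F)))) ≫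
        (liftOf S Kc 𝓜 w h𝓨 e y).left := by
  haveI : IsProper (𝓜.localise w).total.hom := h𝓨.2
  exact ((𝓜.localise w).left_specFractionFieldι_comp_extendPoint_modelPointsEquiv_symm (thickeningLift e (S.M.obj Kc) y)).symm

set_option backward.isDefEq.respectTransparency false in
/-- **SPECIAL POINT EQUALITY** — `red₀ y ≫ ι_s = s̄_R ≫ ỹ` with `s̄_R = Spec (algebraMap R κ̄(w))` under `(toGeomκ w).toAlgebra` (★ (d5) `left_geomReductionMap_comp_fst` +
`specMap_toGeomκ_eq`). [cite: SerreTate1968, §1 Lemma 2] [cite: Hartshorne1977, II.4.7] -/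
theorem left_red₀Of_comp_specialι_eq (h𝓨 : (𝓜.localise w).IsSmoothProper 1) (e : Fi →ₐ[F] AlgebraicClosure (w.adicCompletion F))
    (y : AlgPoints (S.M.obj Kc) (AlgebraicClosure (w.adicCompletion F))) :
    letI := (toGeomκ w).toAlgebra
    (red₀Of S Kc 𝓜 w h𝓨 e y).left ≫ pullback.fst (𝓜.localise w).total.hom (specResidueField w) =
      Spec.map (CommRingCat.ofHom (algebraMap ↥(closureValuationSubring (w.adicCompletion F)) (geomResidueField w))) ≫
        (liftOf S Kc 𝓜 w h𝓨 e y).left := by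
  haveI : IsProper (𝓜.localise w).total.hom := h𝓨.2
  rw [algebraMap_eq_toGeomκ, specMap_toGeomκ_eq, Category.assoc]
  exact (𝓜.localise w).left_geomReductionMap_comp_fst (thickeningLift e (S.M.obj Kc) y)

end Lift

/-! ### (σ1′)–(σ4) In the D-line `Letters` frame: the lifted family of `I`, the two equivariant presentation isos, the transported dock -/

section Letters

-- the frame of the D-line՚s `Letters` section VERBATIM
variable {F : Type} [Field F] [NumberField F] [IsCMField F] {ι₁ : F →+* ℂ}
    {Jstar : Matrix (Fin 2) (Fin 2) F}
    {K₀ : C5.OpenCompactSubgroup ↥(finAdelic ↥(maximalRealSubfield F) F (IsCMField.complexConj F) 2 Jstar)}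
    {S : RecordSystemGS F Jstar ι₁ K₀} {hU7ₛ : S.HeckeTranslateDefinedOver}
    {hJ : (Jstar.map (IsCMField.complexConj F))ᵀ = Jstar} {hJu : IsUnit Jstar}
    {Fi : Type} [Field Fi] [Algebra F Fi] {Kc : C5.SmallLevel K₀} {G : Type} [Group G]
    {𝓜 : IntegralModel (𝓞 F) F ((thickening F Fi).obj (S.M.obj Kc))}
    {w : HeightOneSpectrum (𝓞 F)} {hw : (IsCMField.complexConj F) • w ≠ w} {h𝓨 : (𝓜.localise w).IsSmoothProper 1}
    {θ : ActionOver (𝓜.localise w).total.hom ((Fi ≃ₐ[F] Fi) × G)}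
    {e : Fi →ₐ[F] AlgebraicClosure (w.adicCompletion F)}

set_option backward.isDefEq.respectTransparency false in
/-- **(σ1′) `famOf I y := I.univ ×_𝓨 Spec R`** — the universal abelian scheme of the inputs `I` lifted along `ỹ = liftOf … y` (an `abbrev`: its `.X` is
`(Over.pullback ỹ).obj I.univ.X`, its base changes are those ★ (GF)∕(L-q-sub)∕(GP)∕(DT) quantify over). [cite: SerreTate1968, §1 Lemma 2] -/
abbrev famOf (I : RGDInputsAt F ι₁ Jstar K₀ S hU7ₛ hJ hJu Fi Kc G 𝓜 w hw h𝓨 θ e)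
    (y : AlgPoints (S.M.obj Kc) (AlgebraicClosure (w.adicCompletion F))) :
    AbelianSchemeOver (Spec (.of ↥(closureValuationSubring (w.adicCompletion F)))) :=
  I.univ.baseChange (liftOf S Kc 𝓜 w h𝓨 e y).left

set_option backward.isDefEq.respectTransparency false in
/-- **(σ1′) `actFamOf I y := I.act ×_𝓨 Spec R`** — the `𝒪_F`-action of the lifted family (★ `RingAction.baseChange`; `(actFamOf I y).i a = (Over.pullback ỹ).map (I.act.i a)`, `rfl`).
[cite: Kottwitz1992, §5, p. 390] -/
abbrev actFamOf (I : RGDInputsAt F ι₁ Jstar K₀ S hU7ₛ hJ hJu Fi Kc G 𝓜 w hw h𝓨 θ e)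
    (y : AlgPoints (S.M.obj Kc) (AlgebraicClosure (w.adicCompletion F))) : (famOf I y).RingAction (𝓞 F) :=
  I.act.baseChange (liftOf S Kc 𝓜 w h𝓨 e y).left

set_option backward.isDefEq.respectTransparency false in
/-- **(σ2) THE SPECIAL PRESENTATION ISO, EQUIVARIANT** — the D-line special fibre `sch₀Of 𝓜 w I.univ (red₀ y) = (univ ×_𝓨 𝓨_s) ×_{𝓨_s} red₀ y` IS the special fibre
`(famOf I y) ×_R Spec κ̄` of the lift (under `(toGeomκ w).toAlgebra`), by an isomorphism of `κ̄`-schemes whose `hom` is a homomorphism and which intertwines the two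
base-changed `𝒪_F`-actions (★ (DT) `exists_equivariant_iso_baseChange_baseChange_of_comp_eq` at `left_red₀Of_comp_specialι_eq`; «reduction of points = reduction of
tuples»). [cite: SerreTate1968, §1 Lemma 2] [cite: MumfordFogartyKirwan1994, Ch. 7 §2 Definition 7.2 (p. 129)] -/
theorem exists_iso_special (I : RGDInputsAt F ι₁ Jstar K₀ S hU7ₛ hJ hJu Fi Kc G 𝓜 w hw h𝓨 θ e)
    (y : AlgPoints (S.M.obj Kc) (AlgebraicClosure (w.adicCompletion F))) :
    letI := (toGeomκ w).toAlgebra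
    ∃ ψ : (sch₀Of 𝓜 w I.univ (red₀Of S Kc 𝓜 w h𝓨 e y)).X ≅
        ((famOf I y).baseChange (Spec.map (CommRingCat.ofHom
          (algebraMap ↥(closureValuationSubring (w.adicCompletion F)) (geomResidueField w))))).X,
      IsMonHom ψ.hom ∧
      ∀ a : 𝓞 F,
        ((I.act.baseChange (pullback.fst (𝓜.localise w).total.hom (specResidueField w))).baseChange (red₀Of S Kc 𝓜 w h𝓨 e y).left).i a ≫ ψ.hom =
          ψ.hom ≫ ((actFamOf I y).baseChange (Spec.map (CommRingCat.ofHom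
            (algebraMap ↥(closureValuationSubring (w.adicCompletion F)) (geomResidueField w))))).i a := by
  -- ED. 3 (F1): the NAMED witness ★ `fibreAlongXIso` (= `isoSpecialOf I y` of §1a′ by `isoSpecialOf_eq`); ED. 2 used ★ (DT) `exists_equivariant_iso_baseChange_baseChange_of_comp_eq`.
  letI := (toGeomκ w).toAlgebra
  exact ⟨I.univ.fibreAlongXIso (pullback.fst (𝓜.localise w).total.hom (specResidueField w)) (liftOf S Kc 𝓜 w h𝓨 e y).left
      (left_red₀Of_comp_specialι_eq S Kc 𝓜 w h𝓨 e y),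
    I.univ.isMonHom_fibreAlongXIso_hom _ _ (left_red₀Of_comp_specialι_eq S Kc 𝓜 w h𝓨 e y),
    fun a => I.univ.baseChange_i_comp_fibreAlongXIso_hom _ _ (left_red₀Of_comp_specialι_eq S Kc 𝓜 w h𝓨 e y) I.act a⟩

set_option backward.isDefEq.respectTransparency false in
/-- **(σ3) THE GENERIC PRESENTATION ISO, EQUIVARIANT** — the D-line generic fibre `schΩOf … I.univ y = (univ ×_𝓨 Y) ×_Y ℓ_e y` (the ambient of `LineOf I y`) IS the
generic fibre `(famOf I y) ×_R Spec Ω̄` of the lift, by an isomorphism of `Ω̄`-schemes whose `hom` is a homomorphism and which intertwines `actΩOf … a y` (definitionally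
the base-changed action) with `((actFamOf I y) ×_R Ω̄).i a` (★ (DT) at `left_thickeningLift_comp_genericι_eq`). [cite: SerreTate1968, §1 Lemma 2]
[cite: MumfordFogartyKirwan1994, Ch. 7 §2 Definition 7.2 (p. 129)] -/
theorem exists_iso_generic (I : RGDInputsAt F ι₁ Jstar K₀ S hU7ₛ hJ hJu Fi Kc G 𝓜 w hw h𝓨 θ e)
    (y : AlgPoints (S.M.obj Kc) (AlgebraicClosure (w.adicCompletion F))) :
    ∃ φ : (schΩOf S Kc 𝓜 w e I.univ y).X ≅
        ((famOf I y).baseChange (Spec.map (CommRingCat.ofHom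
          (algebraMap ↥(closureValuationSubring (w.adicCompletion F)) (AlgebraicClosure (w.adicCompletion F)))))).X,
      IsMonHom φ.hom ∧
      ∀ a : 𝓞 F,
        (actΩOf S Kc 𝓜 w e I.univ I.act a y).hom.hom.hom ≫ φ.hom =
          φ.hom ≫ ((actFamOf I y).baseChange (Spec.map (CommRingCat.ofHom
            (algebraMap ↥(closureValuationSubring (w.adicCompletion F)) (AlgebraicClosure (w.adicCompletion F)))))).i a :=
  -- ED. 3 (F1): the NAMED witness ★ `fibreAlongXIso` (= `isoGenericOf I y` of §1a′ by `isoGenericOf_eq`).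
  ⟨I.univ.fibreAlongXIso ((𝓜.localise w).genericIso'.inv.left ≫
        pullback.fst (𝓜.localise w).total.hom (specGenericPoint (HeightOneSpectrum.valuationSubringAtPrime F w) F))
      (liftOf S Kc 𝓜 w h𝓨 e y).left (left_thickeningLift_comp_genericι_eq S Kc 𝓜 w h𝓨 e y),
    I.univ.isMonHom_fibreAlongXIso_hom _ _ (left_thickeningLift_comp_genericι_eq S Kc 𝓜 w h𝓨 e y),
    fun a => I.univ.baseChange_i_comp_fibreAlongXIso_hom _ _ (left_thickeningLift_comp_genericι_eq S Kc 𝓜 w h𝓨 e y) I.act a⟩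

open scoped MonObj CategoryTheory.Obj in
set_option backward.isDefEq.respectTransparency false in
/-- **(σ4) THE DOCK AT `red₀ y` TRANSPORTED TO THE SPECIAL FIBRE OF THE LIFT** — the `DockAt` rows `G₀, ι₀G, hι₀G, hkerG₀` of `𝔡 (red₀Of … y)` give, on
`(famOf I y) ×_R Spec κ̄`, the SAME `G₀` with a monomorphic homomorphism `ι″ : G₀ ⟶ (famOf I y) ×_R κ̄` carrying the kernel-of-`𝔭_{c•w}` clause for `(actFamOf I y) ×_R κ̄`
(★ (DT) `exists_dockTransport_of_comp_eq`; `hrkG₀` is used verbatim).  This is the `(G′, ι′, hG′)` input of the ★ (GF)∕(L-q-sub)∕(GP) dock forms and of §1's `spGeoOf`.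
[cite: Tate1997FiniteFlatGroupSchemes, (3.7)] [cite: SerreTate1968, §1 Lemma 2] -/
theorem exists_dock_special (I : RGDInputsAt F ι₁ Jstar K₀ S hU7ₛ hJ hJu Fi Kc G 𝓜 w hw h𝓨 θ e) [ExpChar (geomResidueField w) I.pChar]
    (𝔡 : ∀ xbar, DockAt I xbar) (y : AlgPoints (S.M.obj Kc) (AlgebraicClosure (w.adicCompletion F))) :
    letI := (toGeomκ w).toAlgebra
    letI := (𝔡 (red₀Of S Kc 𝓜 w h𝓨 e y)).grp₀
    ∃ ι'' : (𝔡 (red₀Of S Kc 𝓜 w h𝓨 e y)).G₀ ⟶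
        ((famOf I y).baseChange (Spec.map (CommRingCat.ofHom
          (algebraMap ↥(closureValuationSubring (w.adicCompletion F)) (geomResidueField w))))).X,
      Mono ι'' ∧ IsMonHom ι'' ∧
      ∀ ⦃W : Over (Spec (.of (geomResidueField w)))⦄
        (t : W ⟶ ((famOf I y).baseChange (Spec.map (CommRingCat.ofHom
          (algebraMap ↥(closureValuationSubring (w.adicCompletion F)) (geomResidueField w))))).X),
        (∃ s : W ⟶ (𝔡 (red₀Of S Kc 𝓜 w h𝓨 e y)).G₀, s ≫ ι'' = t) ↔
          ∀ a ∈ ((IsCMField.complexConj F) • w).asIdeal,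
            t ≫ ((actFamOf I y).baseChange (Spec.map (CommRingCat.ofHom
              (algebraMap ↥(closureValuationSubring (w.adicCompletion F)) (geomResidueField w))))).i a = 1 := by
  letI := (toGeomκ w).toAlgebra
  letI := (𝔡 (red₀Of S Kc 𝓜 w h𝓨 e y)).grp₀
  haveI := (𝔡 (red₀Of S Kc 𝓜 w h𝓨 e y)).hι₀G.1
  haveI : IsClosedImmersion (𝔡 (red₀Of S Kc 𝓜 w h𝓨 e y)).ι₀G.left := (𝔡 (red₀Of S Kc 𝓜 w h𝓨 e y)).hι₀G.2
  haveI : Mono (𝔡 (red₀Of S Kc 𝓜 w h𝓨 e y)).ι₀G := Over.mono_of_mono_left _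
  exact IdealTorsion.exists_dockTransport_of_comp_eq
    (pullback.fst (𝓜.localise w).total.hom (specResidueField w)) (liftOf S Kc 𝓜 w h𝓨 e y).left I.univ I.act
    (left_red₀Of_comp_specialι_eq S Kc 𝓜 w h𝓨 e y) (𝔡 (red₀Of S Kc 𝓜 w h𝓨 e y)).ι₀G
    (fun W t => ((𝔡 (red₀Of S Kc 𝓜 w h𝓨 e y)).hkerG₀ t).symm)

end Letters


/-! ### §2.0 Generic glue (any cartesian monoidal category): a kernel-of-`𝔭` pin moves along an equivariant isomorphism -/

section Glue

open scoped MonObj CategoryTheory.Obj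

set_option backward.isDefEq.respectTransparency false in
/-- **A PIN MOVES ALONG AN EQUIVARIANT ISOMORPHISM**: if `ι₀ : G₀ ↪ A₁` has the kernel-of-`𝔭` universal property for the family `α₁` and `φ : A₁ ≅ A₂` is an
isomorphism of monoid objects with `φ ≫ α₂ a = α₁ a ≫ φ`, then `ι₀ ≫ φ : G₀ ↪ A₂` has the kernel-of-`𝔭` universal property for `α₂` (the dock clause `hkerG₀`
transported; used DOWN → UP below). [cite: Tate1997FiniteFlatGroupSchemes, (1.6)–(1.7) p. 122] -/
theorem forall_exists_comp_eq_iff_of_iso {C : Type*} [Category C] [CartesianMonoidalCategory C] {A₁ A₂ G₀ : C} [MonObj A₁] [MonObj A₂]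
    {O : Type*} {σ : Type*} [SetLike σ O] (𝔭 : σ) (α₁ : O → (A₁ ⟶ A₁)) (α₂ : O → (A₂ ⟶ A₂)) (ι₀ : G₀ ⟶ A₁) (φ : A₁ ≅ A₂) [IsMonHom φ.hom]
    (hφ : ∀ a, φ.hom ≫ α₂ a = α₁ a ≫ φ.hom)
    (h₁ : ∀ ⦃T : C⦄ (t : T ⟶ A₁), (∀ a ∈ 𝔭, t ≫ α₁ a = 1) ↔ ∃ s : T ⟶ G₀, s ≫ ι₀ = t)
    ⦃T : C⦄ (t : T ⟶ A₂) : (∃ s : T ⟶ G₀, s ≫ (ι₀ ≫ φ.hom) = t) ↔ ∀ a ∈ 𝔭, t ≫ α₂ a = 1 := by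
  have hφ' : ∀ a, φ.inv ≫ α₁ a = α₂ a ≫ φ.inv := fun a => by
    rw [Iso.inv_comp_eq, ← Category.assoc, hφ a, Category.assoc, Iso.hom_inv_id, Category.comp_id]
  constructor
  · rintro ⟨s, rfl⟩ a ha
    have h := (h₁ (s ≫ ι₀)).mpr ⟨s, rfl⟩ a ha
    calc (s ≫ ι₀ ≫ φ.hom) ≫ α₂ a = ((s ≫ ι₀) ≫ α₁ a) ≫ φ.hom := by simp only [Category.assoc, hφ a]
      _ = 1 := by rw [h, MonObj.one_comp]
  · intro h
    have h' : ∀ a ∈ 𝔭, (t ≫ φ.inv) ≫ α₁ a = 1 := fun a ha => by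
      rw [Category.assoc, hφ' a, ← Category.assoc, h a ha, MonObj.one_comp]
    obtain ⟨s, hs⟩ := (h₁ (t ≫ φ.inv)).mp h'
    exact ⟨s, by rw [← Category.assoc, hs, Category.assoc, Iso.inv_hom_id, Category.comp_id]⟩

end Glue


/-! (★ re-home, size lint: PART 1 of 6 ends here at tree line :296; the workfile continues, in the same namespace, in `Theorems/F0P6aLineSpecialisationLayer.lean`.) -/

end Summit.HodgeConjecture.HodgeConjecture.Cruxes.HLiu418.F0P6aLineSpecialisation
end
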